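import Literature.IUT.HodgeTheaters.PuncturedEllipticCoveringsCor12OfFreePro
import Literature.IUT.HodgeTheaters.PuncturedEllipticCoveringsCor12InertiaOfCommutatorCusp
import Literature.IUT.HodgeTheaters.PuncturedEllipticCoveringsCor12TorsionFreeFaithful
import Literature.IUT.HodgeTheaters.PuncturedEllipticCoveringsOpenProofs
import Literature.AnabelianGeometry.AbsoluteAnabelian.FreeProfiniteCommutatorCusp
import Literature.AnabelianGeometry.AbsoluteAnabelian.FreeProcyclicModel
import HarnessLib

/-!
# [IUTchI] Cor. 1.2 from "`Δ_X` free profinite on `a, b` with cusp inertia the conjugates of `⟨[a, b]⟩⁻`":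
# the composed closer (`hIH′` derived) and the free procyclicity (`≅ Ẑ`) of the cusp inertia of `X̲` — proof-only

Mochizuki, *Inter-universal Teichmüller theory I*, kurims manuscript (May 2020), §1, pp. 37–39
([IUTchI] §1 pp.37–39) [claim: Mochizuki2012, status: disputed]; *Topics in Absolute Anabelian Geometry III*,
§1, Prop. 1.4 (i) p. 31 ("the inertia group `I_x` of `x` in `Δ_U` is naturally isomorphic to `Ẑ(1)`")
[cite: MochizukiAbsTopIII2015, Prop 1.4 (i) p.31]; *Topics in Absolute Anabelian Geometry I*, Lemma 4.5 (i)
p. 54 (free pro-`Σ` `Δ` of a once-punctured curve) [cite: MochizukiAbsTopI2012, Lemma 4.5 (i) p.54].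
Node `IUTchI:Cor1.2` (plan/L5/SUBDAG-IUTchI-Cor12.md, items (A) + (c) of §A, rows R1 ∘ R2); FACT-LIST rows
F-2464 (`IsFreeProcyclic`) / F-0406 (`CuspidalData.InertiaFreeProcyclic`) — parametrised, admissible at named
instances.  Cell abc-iut, seat abc-iut-f-090 (gen 8), sequel of row «COR12-INERTIA-COMMUTATOR» (p491462
`…Cor12InertiaOfCommutatorCusp.lean`) over abc-iut-L5-t1's row R1 (p491635 `…Cor12OfFreePro.lean`).  PROOF-ONLY
companion (no definitions, no instances, no notation, nothing restated) over abc-iut-L5-t1's FROZEN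
`PuncturedEllipticCoverings.lean` (p404449), abc-iut-L5-d4's `…XbarCuspidalData.lean` (`CuspGalois.cuspidalDataXbar`,
the cusps of `X̲` as abc-iut-L4-t1's `FundamentalExtension.CuspidalData` on the `X̲`-extension), abc-iut-L4's
`FreeProfiniteCommutatorCusp.lean` (`IsFreeProOn.isFreeProcyclic_topologicalClosure_zpowers_commutator`:
`⟨[a, b]⟩⁻` is free procyclic in a free pro-`Σ` group, `Σ ⊇` primes) and `FreeProcyclicModel.lean`
(`IsFreeProcyclic.of_continuousMulEquiv`).

WHAT THIS FILE DOES.  At a datum `D : PuncturedEllipticData` (curve of type `(1, l-tors)`, [IUTchI] §1), ASSUME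
the two origin data isolated by the Cor. 1.2 census —
  (A) `IsFreeProOn ↥Δ_X S gens` (`gens : Fin 2 → Δ_X := Π_X ∩ Δ_C`, `S ⊇` primes): "`Δ_X ≅ F̂₂` free profinite
      on `a = gens 0`, `b = gens 1`" ([AbsTopI] Lem. 4.5 (i) at `X_K = E_K ∖ {O}`), and
  (c) every cusp inertia group `I_x` of `X̲` is the closed procyclic subgroup `⟨g [a, b] g⁻¹⟩⁻` on a
      `Δ_X`-conjugate of the commutator `[a, b]` (the cusp of `X`) —
THEN (§2) every `I_x` is FREE PROCYCLIC (`FundamentalExtension.IsFreeProcyclic`, F-2464 shape: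
`isFreeProcyclic_inertia_of_freePro_commutatorCusp`), (§3) abc-iut-L5-d4's genuine `X̲` cuspidal datum
`C.cuspidalDataXbar` satisfies F-0406 `InertiaFreeProcyclic`
(`CuspGalois.inertiaFreeProcyclic_cuspidalDataXbar_of_freePro_commutatorCusp`) — [AbsTopIII] Prop. 1.4 (i)
"`I_x ≅ Ẑ(1)`" (Galois-module structure forgotten) AT THE GENUINE `X̲` DATUM modulo the displayed origin data
(A) + (c) — and (§4) abc-iut-L5-t1's Cor. 1.2 closer `pe_characteristicNatureOfCoverings_viaX_of_freePro`
(`hrank′` discharged, `hΔ hΔ′` derived from (A)) composes with p491462's `inertia_le_H_of_commutatorCusp_gens`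
into `InitialThetaData.pe_characteristicNatureOfCoverings_viaX_of_freePro_commutatorCusp`, in which the law
`hIH′` is DERIVED from (c′): LAW binders 14 (v6) → 12 + origin data (A) ×2, (c′).  Route for §2: abc-iut-L4's
free-procyclicity of `⟨[a, b]⟩⁻ ≤ Δ_X` is transported along three isomorphisms of topological groups built
in-proof (no `def`): the closed embedding `Δ_X ↪ Π_C` (closure in `Δ_X` = trace of the closure in `Π_C`),
conjugation by `g` (`⟨c⟩⁻ ⥲ ⟨g c g⁻¹⟩⁻`), and `I_x ≤ Π_X̲` viewed inside `Π_X̲` (`subgroupOf`).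

HONEST FRAMING: classical (pro)finite group theory applied to hypothesis binders quoting print; (A) and (c) are
assumption labels (origin data of the étale fundamental group of `X_K`), never asserted; an instance form at a
named datum modulo displayed origin data is not a token flip and not a claim about print; nothing here asserts
that abc is proved or refuted or takes a side on [IUTchIII] Cor. 3.12; typed ≠ inhabited ≠ discharged; no
printed statement is strengthened.
-/

noncomputable section

namespace Literature.IUT.HodgeTheaters

namespace PuncturedEllipticData

open scoped Pointwise
open Topology
open Literature.AnabelianGeometry.AbsoluteAnabelian

universe u

/-! ### Transport: three isomorphisms of topological groups (built in-proof) -/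

section Transport

variable {P : Type*} [Group P] [TopologicalSpace P] [IsTopologicalGroup P]

/-- Conjugation by `g` maps `⟨c⟩⁻` into `⟨g c g⁻¹⟩⁻` (it is continuous and maps `⟨c⟩` onto `⟨g c g⁻¹⟩`).
[folklore] -/
private theorem conj_mem_topologicalClosure_zpowers_conj (g c : P) {x : P}
    (hx : x ∈ (Subgroup.zpowers c).topologicalClosure) :
    g * x * g⁻¹ ∈ (Subgroup.zpowers (g * c * g⁻¹)).topologicalClosure := by
  have hcont : Continuous fun y : P => g * y * g⁻¹ :=
    (continuous_const.mul continuous_id).mul continuous_const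
  rw [← SetLike.mem_coe, Subgroup.topologicalClosure_coe] at hx ⊢
  refine closure_mono ?_ (image_closure_subset_closure_image hcont ⟨x, hx, rfl⟩)
  rintro _ ⟨y, hy, rfl⟩
  obtain ⟨k, rfl⟩ := Subgroup.mem_zpowers_iff.mp hy
  refine Subgroup.mem_zpowers_iff.mpr ⟨k, ?_⟩
  have h := map_zpow (MulAut.conj g) c k
  simp only [MulAut.conj_apply] at h
  exact h.symm

/-- `⟨c⟩⁻ ≃ₜ* ⟨g c g⁻¹⟩⁻` by conjugation. [folklore] -/
private theorem nonempty_continuousMulEquiv_topologicalClosure_zpowers_conj (g c : P) :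
    Nonempty ((Subgroup.zpowers c).topologicalClosure ≃ₜ*
      (Subgroup.zpowers (g * c * g⁻¹)).topologicalClosure) := by
  have e0 : g⁻¹ * (g * c * g⁻¹) * g⁻¹⁻¹ = c := by group
  have hinv : ∀ y : P, y ∈ (Subgroup.zpowers (g * c * g⁻¹)).topologicalClosure →
      g⁻¹ * y * g⁻¹⁻¹ ∈ (Subgroup.zpowers c).topologicalClosure := fun y hy => by
    have h := conj_mem_topologicalClosure_zpowers_conj g⁻¹ (g * c * g⁻¹) hy
    rwa [e0] at h
  exact ⟨{ toFun := fun x => ⟨g * x * g⁻¹, conj_mem_topologicalClosure_zpowers_conj g c x.2⟩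
           invFun := fun y => ⟨g⁻¹ * y * g⁻¹⁻¹, hinv y y.2⟩
           left_inv := fun x => Subtype.ext (show g⁻¹ * (g * (x : P) * g⁻¹) * g⁻¹⁻¹ = x by group)
           right_inv := fun y => Subtype.ext (show g * (g⁻¹ * (y : P) * g⁻¹⁻¹) * g⁻¹ = y by group)
           map_mul' := fun x y => Subtype.ext
             (show g * ((x : P) * y) * g⁻¹ = g * x * g⁻¹ * (g * y * g⁻¹) by group)
           continuous_toFun :=
             ((continuous_const.mul continuous_subtype_val).mul continuous_const).subtype_mk _
           continuous_invFun :=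
             ((continuous_const.mul continuous_subtype_val).mul continuous_const).subtype_mk _ }⟩

/-- For a CLOSED subgroup `Δ ≤ P` and `c ∈ Δ`, the closed procyclic subgroup `⟨c⟩⁻` computed inside `Δ`
is `≃ₜ*` the one computed inside `P` (`Δ ↪ P` is a closed embedding: the closure in `Δ` is the trace of the
closure in `P`, which lies in `Δ`). [folklore] -/
private theorem nonempty_continuousMulEquiv_topologicalClosure_zpowers_subtype {Δ : Subgroup P}
    (hΔ : IsClosed (Δ : Set P)) (c : Δ) (c' : P) (hc : (c : P) = c') :
    Nonempty ((Subgroup.zpowers c).topologicalClosure ≃ₜ*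
      (Subgroup.zpowers c').topologicalClosure) := by
  subst hc
  -- `val '' ⟨c⟩ = ⟨↑c⟩`
  have himg : (Subtype.val : Δ → P) '' ((Subgroup.zpowers c : Subgroup Δ) : Set Δ) =
      ((Subgroup.zpowers (c : P) : Subgroup P) : Set P) := by
    have h := congrArg SetLike.coe (MonoidHom.map_zpowers Δ.subtype c)
    rwa [Subgroup.coe_map, Subgroup.coe_subtype] at h
  -- the closure inside `Δ` is the preimage of the closure inside `P` (`val` is inducing)
  have hmem : ∀ x : Δ, x ∈ (Subgroup.zpowers c).topologicalClosure ↔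
      (x : P) ∈ (Subgroup.zpowers (c : P)).topologicalClosure := fun x => by
    rw [← SetLike.mem_coe, ← SetLike.mem_coe, Subgroup.topologicalClosure_coe,
      Subgroup.topologicalClosure_coe, Topology.IsInducing.subtypeVal.closure_eq_preimage_closure_image,
      Set.mem_preimage]
    exact ⟨fun h => closure_mono himg.subset h, fun h => closure_mono himg.symm.subset h⟩
  -- the closure inside `P` lies in `Δ`
  have hle : (Subgroup.zpowers (c : P)).topologicalClosure ≤ Δ :=
    Subgroup.topologicalClosure_minimal _ ((Subgroup.zpowers_le).mpr c.2) hΔ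
  exact ⟨{ toFun := fun x => ⟨((x : Δ) : P), (hmem x.1).mp x.2⟩
           invFun := fun y => ⟨⟨(y : P), hle y.2⟩, (hmem ⟨(y : P), hle y.2⟩).mpr y.2⟩
           left_inv := fun _ => rfl
           right_inv := fun _ => rfl
           map_mul' := fun _ _ => rfl
           continuous_toFun := (continuous_subtype_val.comp continuous_subtype_val).subtype_mk _
           continuous_invFun := (continuous_subtype_val.subtype_mk _).subtype_mk _ }⟩

omit [IsTopologicalGroup P] in
/-- For subgroups `A ≤ B` of `P`, `A` viewed inside `B` (`A.subgroupOf B`) is `≃ₜ*` `A`. [folklore] -/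
private theorem nonempty_continuousMulEquiv_subgroupOf {A B : Subgroup P} (h : A ≤ B) :
    Nonempty (A.subgroupOf B ≃ₜ* A) :=
  ⟨{ toFun := fun x => ⟨((x : B) : P), x.2⟩
     invFun := fun y => ⟨⟨(y : P), h y.2⟩, y.2⟩
     left_inv := fun _ => rfl
     right_inv := fun _ => rfl
     map_mul' := fun _ _ => rfl
     continuous_toFun := (continuous_subtype_val.comp continuous_subtype_val).subtype_mk _
     continuous_invFun := (continuous_subtype_val.subtype_mk _).subtype_mk _ }⟩

end Transport

/-! ### [IUTchI] §1: the cusp inertia groups of `X̲` are free procyclic, from (A) + (c) -/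

variable (D : PuncturedEllipticData.{u})

/-- **The cusp inertia groups of `X̲` are free procyclic (`≅ Ẑ`), from (A) + (c).**  If `Δ_X = Π_X ∩ Δ_C` is
free pro-`Σ` on `gens : Fin 2 → Δ_X` with `Σ ⊇` primes ([AbsTopI] Lem. 4.5 (i): `Δ_X ≅ F̂₂`) and every cusp
inertia group `I_x` of `X̲` is the closed procyclic subgroup `⟨g [a, b] g⁻¹⟩⁻` on a `Δ_X`-conjugate of the
commutator of `a = gens 0`, `b = gens 1` (the cusp of `X`), then every `I_x` is free procyclic — [AbsTopIII]
Prop. 1.4 (i) "`I_x ≅ Ẑ(1)`" with the Galois-module structure forgotten (FACT-LIST F-2464 shape), at the cusps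
of `X̲`. ([IUTchI] §1 p.37) [claim: Mochizuki2012, status: disputed]
[cite: MochizukiAbsTopIII2015, Prop 1.4 (i) p.31] -/
theorem isFreeProcyclic_inertia_of_freePro_commutatorCusp {S : Set ℕ}
    (hS : ∀ p : ℕ, p.Prime → p ∈ S) {gens : Fin 2 → ↥(D.PiX ⊓ D.DeltaC)}
    (hfree : IsFreeProOn ↥(D.PiX ⊓ D.DeltaC) S gens)
    (hcusp : ∀ x : D.Cusp, ∃ g ∈ D.PiX ⊓ D.DeltaC,
      D.inertia x = (Subgroup.zpowers (g * ((gens 0 : D.PiC) * (gens 1 : D.PiC) *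
        (gens 0 : D.PiC)⁻¹ * (gens 1 : D.PiC)⁻¹) * g⁻¹)).topologicalClosure) :
    ∀ x : D.Cusp, FundamentalExtension.IsFreeProcyclic (D.inertia x) := by
  intro x
  obtain ⟨g, -, hx⟩ := hcusp x
  -- (1) inside `Δ_X`: `⟨[gens 0, gens 1]⟩⁻` is free procyclic (abc-iut-L4, `FreeProfiniteCommutatorCusp`)
  have h1 := hfree.isFreeProcyclic_topologicalClosure_zpowers_commutator hS
    (show (0 : Fin 2) ≠ 1 by decide)
  -- (2) push into `Π_C` along the closed embedding `Δ_X ↪ Π_C` (`Δ_X` closed: abc-iut-L5-t1 p491635)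
  obtain ⟨e2⟩ := nonempty_continuousMulEquiv_topologicalClosure_zpowers_subtype D.isClosed_piX_inf_deltaC
    (gens 0 * gens 1 * (gens 0)⁻¹ * (gens 1)⁻¹)
    ((gens 0 : D.PiC) * (gens 1 : D.PiC) * (gens 0 : D.PiC)⁻¹ * (gens 1 : D.PiC)⁻¹) rfl
  -- (3) conjugate by `g`
  obtain ⟨e3⟩ := nonempty_continuousMulEquiv_topologicalClosure_zpowers_conj g
    ((gens 0 : D.PiC) * (gens 1 : D.PiC) * (gens 0 : D.PiC)⁻¹ * (gens 1 : D.PiC)⁻¹)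
  rw [hx]
  exact (h1.of_continuousMulEquiv e2).of_continuousMulEquiv e3

variable {D}

namespace CuspGalois

variable (C : D.CuspGalois)

/-- The inertia group of abc-iut-L5-d4's `X̲` cuspidal datum at `x`, pushed into `Π_C`, is `I_x = D_x ∩ Δ_C`: as a
subgroup of `Π_X̲` it is `I_x` viewed inside `Π_X̲`. ([IUTchI] §1 p.37) [claim: Mochizuki2012, status: disputed] -/
theorem cuspidalDataXbar_Icusp (x : D.Cusp) :
    C.cuspidalDataXbar.Icusp x = (D.inertia x).subgroupOf D.PiXbar := by
  ext y
  constructor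
  · rintro ⟨h1, h2⟩
    exact ⟨h1, (mem_extXbar_geom_iff y).mp h2⟩
  · rintro ⟨h1, h2⟩
    exact ⟨h1, (mem_extXbar_geom_iff y).mpr h2⟩

/-- **F-0406 `InertiaFreeProcyclic` at the genuine `X̲` cuspidal datum, from (A) + (c).**  Under the origin data
(A) "`Δ_X` free pro-`Σ` on `gens : Fin 2 → Δ_X`, `Σ ⊇` primes" and (c) "every cusp inertia group of `X̲` is
`⟨g [gens 0, gens 1] g⁻¹⟩⁻`, `g ∈ Δ_X`", abc-iut-L5-d4's cuspidal datum `C.cuspidalDataXbar` (the cusps of `X̲`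
on the extension `Π_X̲ ↠ aug(Π_X̲)`) has free procyclic inertia groups: [AbsTopIII] Prop. 1.4 (i) "the inertia
group `I_x` … is naturally isomorphic to `Ẑ(1)`" as typed by abc-iut-L4-t1's `CuspidalData.InertiaFreeProcyclic`
(FACT-LIST F-0406, parametrised; admissible at named instances) — an INSTANCE FORM at the genuine `X̲` datum
modulo displayed origin data, not a discharge of the row. ([IUTchI] §1 p.37) [claim: Mochizuki2012, status:
disputed] [cite: MochizukiAbsTopIII2015, Prop 1.4 (i) p.31] -/
theorem inertiaFreeProcyclic_cuspidalDataXbar_of_freePro_commutatorCusp {S : Set ℕ}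
    (hS : ∀ p : ℕ, p.Prime → p ∈ S) {gens : Fin 2 → ↥(D.PiX ⊓ D.DeltaC)}
    (hfree : IsFreeProOn ↥(D.PiX ⊓ D.DeltaC) S gens)
    (hcusp : ∀ x : D.Cusp, ∃ g ∈ D.PiX ⊓ D.DeltaC,
      D.inertia x = (Subgroup.zpowers (g * ((gens 0 : D.PiC) * (gens 1 : D.PiC) *
        (gens 0 : D.PiC)⁻¹ * (gens 1 : D.PiC)⁻¹) * g⁻¹)).topologicalClosure) :
    C.cuspidalDataXbar.InertiaFreeProcyclic := by
  intro x
  rw [C.cuspidalDataXbar_Icusp x]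
  have hle : D.inertia x ≤ D.PiXbar := inf_le_left.trans (D.decomp_le x)
  obtain ⟨e⟩ := nonempty_continuousMulEquiv_subgroupOf hle
  exact (D.isFreeProcyclic_inertia_of_freePro_commutatorCusp hS hfree hcusp x).of_continuousMulEquiv e.symm

end CuspGalois

end PuncturedEllipticData

/-! ### [IUTchI] Cor. 1.2: the closer of record with `hIH′` derived from (c′) — rows R1 ∘ R2 composed -/

namespace InitialThetaData

open scoped Pointwise
open Literature.AnabelianGeometry.AbsoluteAnabelian
open Literature.AnabelianGeometry.AbsoluteAnabelian.FundamentalExtension (CuspidalAlgorithm)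
open Literature.AnabelianGeometry.AbsoluteAnabelian.AbsTopII (semiEllipticDoubleCoverSubgroups)

universe v v'

variable {F : Type v} {K : Type} {Fbar : Type} [Field F] [NumberField F] [Field K] [NumberField K]
  [Algebra F K] [Field Fbar] [Algebra F Fbar] [Algebra K Fbar]
  {E : WeierstrassCurve F} [E.IsElliptic] {l : ℕ} {Pb : BadPlacePredicates K}
  (D : InitialThetaData F K Fbar E l Pb)
  {F' : Type v'} {K' : Type} [Field F'] [NumberField F'] [Field K'] [NumberField K'] [Algebra F' K']
  {Fbar' : Type} [Field Fbar'] [Algebra F' Fbar'] [Algebra K' Fbar']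
  {E' : WeierstrassCurve F'} [E'.IsElliptic] {l' : ℕ} {Pb' : BadPlacePredicates K'}
  (D' : InitialThetaData F' K' Fbar' E' l' Pb')

/-- **[IUTchI] Cor. 1.2 between the `K`-level data of two initial Θ-data — abc-iut-L5-t1's closer
`pe_characteristicNatureOfCoverings_viaX_of_freePro` (p491635: `hrank′` discharged, `hΔ hΔ′` derived from (A))
with the law `hIH′` ALSO DERIVED, from the origin datum (c′) at the primed datum** («every cusp inertia group of
`X̲′` is `⟨g [gens′ 0, gens′ 1] g⁻¹⟩⁻`, `g ∈ Δ′_X`», [AbsTopI] Lem. 4.5 (i) at `X_{K′}`; abc-iut-f-090's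
`PuncturedEllipticData.inertia_le_H_of_commutatorCusp_gens`, p491462) — rows R1 ∘ R2 of
plan/L5/SUBDAG-IUTchI-Cor12.md composed.  Remaining LAW binders: `hL L′ h0 h0′ htf huniq′ hext hextC hA hA′`
(10) + the origin-shaped `hfree hfree′` (A) and `hcusp′` (c′); DATA `C C′ A`.  NOTE (abc-iut-L5-t1 FINDING
T1g11-F1, 2026-08-27): the binder `htf : IsMulTorsionFree ↥(Π_X ⊓ Δ_C)` (Mathlib: unique roots) is carried
VERBATIM from the closer of record and is argued UNSATISFIABLE where `Δ_X ≅ F̂₂`; it is an assumption label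
here, pending the leads' re-typing. ([IUTchI] Cor 1.2 p.39) [claim: Mochizuki2012, status: disputed] -/
theorem pe_characteristicNatureOfCoverings_viaX_of_freePro_commutatorCusp
    (C : D.geom.pe.CuspGalois) (C' : D'.geom.pe.CuspGalois)
    (hL : D.geom.pe.ModLCuspLaws) (L' : D'.geom.pe.ModLCuspLaws)
    {gens : Fin 2 → ↥(D.geom.pe.PiX ⊓ D.geom.pe.DeltaC)}
    (hfree : IsFreeProOn ↥(D.geom.pe.PiX ⊓ D.geom.pe.DeltaC) Set.univ gens)
    {gens' : Fin 2 → ↥(D'.geom.pe.PiX ⊓ D'.geom.pe.DeltaC)}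
    (hfree' : IsFreeProOn ↥(D'.geom.pe.PiX ⊓ D'.geom.pe.DeltaC) Set.univ gens')
    (hcusp' : ∀ x : D'.geom.pe.Cusp, ∃ g ∈ D'.geom.pe.PiX ⊓ D'.geom.pe.DeltaC,
      D'.geom.pe.inertia x = (Subgroup.zpowers (g * ((gens' 0 : D'.geom.pe.PiC) * (gens' 1 : D'.geom.pe.PiC) *
        (gens' 0 : D'.geom.pe.PiC)⁻¹ * (gens' 1 : D'.geom.pe.PiC)⁻¹) * g⁻¹)).topologicalClosure)
    (h0 : ¬ D.geom.pe.inertia D.geom.pe.ε0 ≤ D.geom.pe.piXarrow)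
    (h0' : ¬ D'.geom.pe.inertia D'.geom.pe.ε0 ≤ D'.geom.pe.piXarrow)
    (htf : IsMulTorsionFree ↥(D.geom.pe.PiX ⊓ D.geom.pe.DeltaC))
    (huniq' : ∀ J ∈ semiEllipticDoubleCoverSubgroups D'.geom.pe.E,
      J ⊓ D'.geom.pe.DeltaC = D'.geom.pe.PiX ⊓ D'.geom.pe.DeltaC)
    (hext : ∀ φ : D.geom.pe.piXarrow ≃* D'.geom.pe.piXarrow, Continuous φ → Continuous φ.symm →
      ∃ Θ : D.geom.pe.PiC ≃ₜ* D'.geom.pe.PiC,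
        ∀ x : D.geom.pe.piXarrow, Θ (x : D.geom.pe.PiC) = (φ x : D'.geom.pe.PiC))
    (hextC : ∀ ψ : D.geom.pe.piCarrow ≃* D'.geom.pe.piCarrow, Continuous ψ → Continuous ψ.symm →
      ∃ Θ : D.geom.pe.PiC ≃ₜ* D'.geom.pe.PiC,
        ∀ x : D.geom.pe.piCarrow, Θ (x : D.geom.pe.PiC) = (ψ x : D'.geom.pe.PiC))
    (A : CuspidalAlgorithm.{0}) (hA : A.RecoversCusps D.geom.pe.extXbar C.cuspidalDataXbar)
    (hA' : A.RecoversCusps D'.geom.pe.extXbar C'.cuspidalDataXbar) :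
    D.geom.pe.CharacteristicNatureOfCoverings D'.geom.pe :=
  D.pe_characteristicNatureOfCoverings_viaX_of_freePro D' C C' hL L' hfree hfree' h0 h0' htf huniq' hext hextC
    A hA hA' (D'.geom.pe.inertia_le_H_of_commutatorCusp_gens gens' hcusp')

end InitialThetaData

end Literature.IUT.HodgeTheaters

/-! ### Appendix (2026-08-27, same seat): (L0) of `ModLCuspLaws` from (A); the composition on top of the
PRINT-FAITHFUL closer p492999 -/

namespace Literature.IUT.HodgeTheaters.PuncturedEllipticData

open Literature.AnabelianGeometry.AbsoluteAnabelian

universe u₁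

/-- **(L0) of abc-iut-L5-t1's `ModLCuspLaws` from (A)**: if `Δ_X = Π_X ∩ Δ_C` is free profinite of finite rank
(`IsFreeProOn ↥Δ_X Set.univ gens`), then "`Δ_X̲^{ab} ⊗ (ℤ/lℤ)`" (p. 37 l. 31) is finite —
`[Δ_X̲ : Ker(Δ_X̲ ↠ Δ_X̲^{ab} ⊗ ℤ/l)] ≠ 0`: `Δ_X` is topologically finitely generated
(`IsFreeProOn.isTopologicallyFinitelyGenerated`), so is its open subgroup `Δ_X̲ = Δ_X ∩ Π_C̲` (Schreier,
`IsTopologicallyFinitelyGenerated.subgroup_isOpen`), whence (L0) by abc-iut-L5-d4's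
`modLKer_relIndex_ne_zero_of_tfg` (p424558).  With p491462's `inertia_procyclic_of_commutatorCusp` ((L1) from (c))
the record `ModLCuspLaws` keeps four genuinely `Δ_ε`-level laws (L2a) (L2c) (L3) (L4) beyond the origin data
(A) + (c). ([IUTchI] §1 p.37) [claim: Mochizuki2012, status: disputed] -/
theorem modLKer_relIndex_ne_zero_of_isFreeProOn (D : PuncturedEllipticData.{u₁}) {n : ℕ}
    {gens : Fin n → ↥(D.PiX ⊓ D.DeltaC)} (hfree : IsFreeProOn ↥(D.PiX ⊓ D.DeltaC) Set.univ gens) :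
    D.modLKer.relIndex D.DeltaXbar ≠ 0 := by
  haveI : CompactSpace ↥(D.PiX ⊓ D.DeltaC) :=
    isCompact_iff_compactSpace.mp D.isClosed_piX_inf_deltaC.isCompact
  -- `Δ_X̲ = Δ_X ∩ Π_C̲`, viewed inside `Δ_X`, is the trace of the open `Π_C̲`
  have hU : IsOpen ((D.DeltaXbar.subgroupOf (D.PiX ⊓ D.DeltaC) : Subgroup ↥(D.PiX ⊓ D.DeltaC)) :
      Set ↥(D.PiX ⊓ D.DeltaC)) := by
    have e : ((D.DeltaXbar.subgroupOf (D.PiX ⊓ D.DeltaC) : Subgroup ↥(D.PiX ⊓ D.DeltaC)) :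
        Set ↥(D.PiX ⊓ D.DeltaC)) = Subtype.val ⁻¹' (D.PiCbar : Set D.PiC) := by
      ext x
      rw [SetLike.mem_coe, Subgroup.mem_subgroupOf, Set.mem_preimage, SetLike.mem_coe]
      constructor
      · intro hx
        exact (Subgroup.mem_inf.mp (Subgroup.mem_inf.mp hx).1).2
      · intro hx
        exact Subgroup.mem_inf.mpr ⟨Subgroup.mem_inf.mpr ⟨(Subgroup.mem_inf.mp x.2).1, hx⟩,
          (Subgroup.mem_inf.mp x.2).2⟩
    rw [e]
    exact D.isOpen_piCbar.preimage continuous_subtype_val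
  have htfg := (hfree.isTopologicallyFinitelyGenerated).subgroup_isOpen _ hU
  obtain ⟨e⟩ := nonempty_continuousMulEquiv_subgroupOf (P := D.PiC) (deltaXbar_le_deltaX (D := D))
  exact D.modLKer_relIndex_ne_zero_of_tfg (htfg.of_continuousMulEquiv e)

end Literature.IUT.HodgeTheaters.PuncturedEllipticData

namespace Literature.IUT.HodgeTheaters.InitialThetaData

open scoped Pointwise
open Literature.AnabelianGeometry.AbsoluteAnabelian
open Literature.AnabelianGeometry.AbsoluteAnabelian.FundamentalExtension (CuspidalAlgorithm)

universe w w'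

variable {F : Type w} {K : Type} {Fbar : Type} [Field F] [NumberField F] [Field K] [NumberField K]
  [Algebra F K] [Field Fbar] [Algebra F Fbar] [Algebra K Fbar]
  {E : WeierstrassCurve F} [E.IsElliptic] {l : ℕ} {Pb : BadPlacePredicates K}
  (D : InitialThetaData F K Fbar E l Pb)
  {F' : Type w'} {K' : Type} [Field F'] [NumberField F'] [Field K'] [NumberField K'] [Algebra F' K']
  {Fbar' : Type} [Field Fbar'] [Algebra F' Fbar'] [Algebra K' Fbar']
  {E' : WeierstrassCurve F'} [E'.IsElliptic] {l' : ℕ} {Pb' : BadPlacePredicates K'}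
  (D' : InitialThetaData F' K' Fbar' E' l' Pb')

/-- **[IUTchI] Cor. 1.2 between the `K`-level data of two initial Θ-data — the PRINT-FAITHFUL closer of record
`pe_characteristicNatureOfCoverings_viaX_of_freePro_faithful` (p492999: the vacuous Mathlib-`IsMulTorsionFree`
binder `htf` REMOVED — "`Δ_X` torsion-free" in print's `IsOfFinOrder` sense discharged from (A) —, `huniq` in
print's form, `hrank′` discharged, `hΔ hΔ′` derived from (A)) with the law `hIH′` ALSO DERIVED from the origin
datum (c′) at the primed datum** («every cusp inertia group of `X̲′` is `⟨g [gens′ 0, gens′ 1] g⁻¹⟩⁻`, `g ∈ Δ′_X`»,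
[AbsTopI] Lem. 4.5 (i) at `X_{K′}`; `PuncturedEllipticData.inertia_le_H_of_commutatorCusp_gens`, p491462).
Remaining LAW binders: `hL L′` (abc-iut-L5-t1's `ModLCuspLaws`), `h0 h0′` (GAP G-L5d4g6-1), `huniq`, `hext hextC`
([AbsTopII] Cor. 3.3 (i) extension form), `hA hA′` (F-0206 instances) — 9; origin-shaped `hfree hfree′` (A) and
`hcusp′` (c′); DATA `C C′ A`. ([IUTchI] Cor 1.2 p.39) [claim: Mochizuki2012, status: disputed] -/
theorem pe_characteristicNatureOfCoverings_viaX_of_freePro_faithful_commutatorCusp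
    (C : D.geom.pe.CuspGalois) (C' : D'.geom.pe.CuspGalois)
    (hL : D.geom.pe.ModLCuspLaws) (L' : D'.geom.pe.ModLCuspLaws)
    {gens : Fin 2 → ↥(D.geom.pe.PiX ⊓ D.geom.pe.DeltaC)}
    (hfree : IsFreeProOn ↥(D.geom.pe.PiX ⊓ D.geom.pe.DeltaC) Set.univ gens)
    {gens' : Fin 2 → ↥(D'.geom.pe.PiX ⊓ D'.geom.pe.DeltaC)}
    (hfree' : IsFreeProOn ↥(D'.geom.pe.PiX ⊓ D'.geom.pe.DeltaC) Set.univ gens')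
    (hcusp' : ∀ x : D'.geom.pe.Cusp, ∃ g ∈ D'.geom.pe.PiX ⊓ D'.geom.pe.DeltaC,
      D'.geom.pe.inertia x = (Subgroup.zpowers (g * ((gens' 0 : D'.geom.pe.PiC) * (gens' 1 : D'.geom.pe.PiC) *
        (gens' 0 : D'.geom.pe.PiC)⁻¹ * (gens' 1 : D'.geom.pe.PiC)⁻¹) * g⁻¹)).topologicalClosure)
    (h0 : ¬ D.geom.pe.inertia D.geom.pe.ε0 ≤ D.geom.pe.piXarrow)
    (h0' : ¬ D'.geom.pe.inertia D'.geom.pe.ε0 ≤ D'.geom.pe.piXarrow)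
    (huniq : ∀ J : Subgroup D'.geom.pe.PiC, IsOpen (J : Set D'.geom.pe.PiC) → J.index = 2 →
      (∀ g : ↥(J ⊓ D'.geom.pe.DeltaC), IsOfFinOrder g → g = 1) →
        J ⊓ D'.geom.pe.DeltaC = D'.geom.pe.PiX ⊓ D'.geom.pe.DeltaC)
    (hext : ∀ φ : D.geom.pe.piXarrow ≃* D'.geom.pe.piXarrow, Continuous φ → Continuous φ.symm →
      ∃ Θ : D.geom.pe.PiC ≃ₜ* D'.geom.pe.PiC,
        ∀ x : D.geom.pe.piXarrow, Θ (x : D.geom.pe.PiC) = (φ x : D'.geom.pe.PiC))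
    (hextC : ∀ ψ : D.geom.pe.piCarrow ≃* D'.geom.pe.piCarrow, Continuous ψ → Continuous ψ.symm →
      ∃ Θ : D.geom.pe.PiC ≃ₜ* D'.geom.pe.PiC,
        ∀ x : D.geom.pe.piCarrow, Θ (x : D.geom.pe.PiC) = (ψ x : D'.geom.pe.PiC))
    (A : CuspidalAlgorithm.{0}) (hA : A.RecoversCusps D.geom.pe.extXbar C.cuspidalDataXbar)
    (hA' : A.RecoversCusps D'.geom.pe.extXbar C'.cuspidalDataXbar) :
    D.geom.pe.CharacteristicNatureOfCoverings D'.geom.pe :=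
  D.pe_characteristicNatureOfCoverings_viaX_of_freePro_faithful D' C C' hL L' hfree hfree' h0 h0' huniq hext
    hextC A hA hA' (D'.geom.pe.inertia_le_H_of_commutatorCusp_gens gens' hcusp')

end Literature.IUT.HodgeTheaters.InitialThetaData
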